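import Summits.MatrixMultiplication.OmegaCensus.DihedralLikeModel
import HarnessLib

/-!
# Transport of the dihedral-like model along `(A, c₀) ≅ (A′, c₀′)`; all involutions of `ℤ₂ × ℤ_n` except `(0, n/2)`, `4 ∣ n`

ω-census, family (b3).  Framing: lottery ticket; floor = certified bounds/negative ranges.

* `DihedralLikeGroup.congr`: an additive isomorphism `φ : A ≃+ B` with `φ c₀ = c₀′` induces a group isomorphism
  `G(A, c₀) ≃* G(B, c₀′)` (`rho a ↦ rho (φ a)`, `tau a ↦ tau (φ a)`); `tpp_map_mulEquiv`: TPP triples and their volumes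
  transport along group isomorphisms.
* Over `A = ℤ₂ × ℤ_n`, `n` even, the involutions are `(1,0), (0,n/2), (1,n/2)`.  The shear `(a,b) ↦ (a, b + (n/2)·a)`
  (`shearEquiv`) maps `(1,0) ↦ (1,n/2)`; for `n ≡ 2 (mod 4)` the map `(a,b) ↦ (b mod 2, (n/2)·a + b)` (`swapEquiv`) is an
  automorphism with `(1,0) ↦ (0,n/2)`.  Hence (`z2zn_mod_one_law_attained_one_half`, `…_zero_half`): for `n ≡ 2 (mod 3)` the
  mod-one law `3|S||T||U| + 8 = 8|A|` is attained in `G(ℤ₂ × ℤ_n, (1, n/2))` (all even `n`) and in `G(ℤ₂ × ℤ_n, (0, n/2))`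
  when `n ≡ 2 (mod 4)` — by transport from `G(ℤ₂ × ℤ_n, (1,0)) = ℤ_n ⋊ ℤ₄` (`z2zn_mod_one_law_attained`).  Together with
  `c2_dihedral_law` (`c₀ = 0`) and `no_mod_one_law_Z2_Zn_half` (`c₀ = (0,n/2)`, `4 ∣ n`: NOT attained) this makes the
  per-`c₀` table over `ℤ₂ × ℤ_n` entirely kernel: every dihedral-like group over `ℤ₂ × ℤ_n` (`n ≡ 2 (mod 3)`, `n ≥ 8`)
  attains the law except `C₂ × Q_{2n}` with `4 ∣ n`.
-/

namespace Summit.MatrixMultiplication.OmegaCensus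

open Literature.Combinatorics.Additive Finset

namespace DihedralLikeGroup

variable {A B : Type} [AddCommGroup A] [AddCommGroup B] {c₀ : A} {c₀' : B}
  [Fact (c₀ + c₀ = 0)] [Fact (c₀' + c₀' = 0)]

/-- **Transport of the model**: `φ : A ≃+ B` with `φ c₀ = c₀′` induces `G(A,c₀) ≃* G(B,c₀′)`. [folklore] -/
def congr (φ : A ≃+ B) (hφ : φ c₀ = c₀') : DihedralLikeGroup A c₀ ≃* DihedralLikeGroup B c₀' where
  toFun g := match g with
    | rho a => rho (φ a)
    | tau a => tau (φ a)
  invFun g := match g with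
    | rho b => rho (φ.symm b)
    | tau b => tau (φ.symm b)
  left_inv := by rintro (a | a) <;> simp
  right_inv := by rintro (b | b) <;> simp
  map_mul' := by
    rintro (a | a) (b | b)
    · show rho (φ (a + b)) = rho (φ a + φ b); rw [map_add]
    · show tau (φ (b - a)) = tau (φ b - φ a); rw [map_sub]
    · show tau (φ (a + b)) = tau (φ a + φ b); rw [map_add]
    · show rho (φ (c₀ + b - a)) = rho (c₀' + φ b - φ a); rw [map_sub, map_add, hφ]

end DihedralLikeGroup

section Transport

variable {G H : Type*} [Group G] [Group H] [DecidableEq H]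

/-- TPP triples transport along a group isomorphism, with the same cardinalities. [folklore] -/
theorem tpp_map_mulEquiv (e : G ≃* H) {S T U : Finset G} (h : TripleProductProperty S T U) :
    TripleProductProperty (S.image e) (T.image e) (U.image e) ∧
      (S.image e).card = S.card ∧ (T.image e).card = T.card ∧ (U.image e).card = U.card := by
  refine ⟨?_, card_image_of_injective _ e.injective, card_image_of_injective _ e.injective,
    card_image_of_injective _ e.injective⟩
  refine tpp_lift e.symm.toMonoidHom h ?_ ?_ ?_ (e.symm.injective.injOn) (e.symm.injective.injOn)
  · intro x hx; obtain ⟨s, hs, rfl⟩ := mem_image.1 hx; simpa using hs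
  · intro x hx; obtain ⟨s, hs, rfl⟩ := mem_image.1 hx; simpa using hs
  · intro x hx; obtain ⟨s, hs, rfl⟩ := mem_image.1 hx; simpa using hs

/-- Existence of a TPP triple of given volume transports along a group isomorphism. [folklore] -/
theorem exists_tpp_volume_of_mulEquiv (e : G ≃* H) {V : ℕ}
    (h : ∃ S T U : Finset G, TripleProductProperty S T U ∧ S.card * T.card * U.card = V) :
    ∃ S T U : Finset H, TripleProductProperty S T U ∧ S.card * T.card * U.card = V := by
  obtain ⟨S, T, U, h, hV⟩ := h
  obtain ⟨h', cS, cT, cU⟩ := tpp_map_mulEquiv e h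
  exact ⟨_, _, _, h', by rw [cS, cT, cU, hV]⟩

end Transport

/-! ## The involutions of `ℤ₂ × ℤ_n` -/

section Z2Zn

variable {n : ℕ} [NeZero n]

omit [NeZero n] in
/-- `2 · (n/2) = 0` in `ℤ_n` for even `n`. [folklore] -/
theorem two_nsmul_half (hn : 2 ∣ n) : (2 : ℕ) • ((n / 2 : ℕ) : ZMod n) = 0 := by
  rw [nsmul_eq_mul, ← Nat.cast_mul, Nat.mul_div_cancel' hn, ZMod.natCast_self]

/-- The homomorphism `ℤ₂ → ℤ_n`, `a ↦ a·(n/2)` (well defined for even `n`). [folklore] -/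
def halfHom (n : ℕ) [NeZero n] (hn : 2 ∣ n) : ZMod 2 →+ ZMod n :=
  ZMod.lift 2 ⟨zmultiplesHom (ZMod n) ((n / 2 : ℕ) : ZMod n), by
    show ((2 : ℕ) : ℤ) • ((n / 2 : ℕ) : ZMod n) = 0
    rw [natCast_zsmul]; exact two_nsmul_half hn⟩

/-- `halfHom 1 = n/2`. [folklore] -/
theorem halfHom_one (hn : 2 ∣ n) : halfHom n hn 1 = ((n / 2 : ℕ) : ZMod n) := by
  have : (1 : ZMod 2) = ((1 : ℤ) : ZMod 2) := by rw [Int.cast_one]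
  rw [this, halfHom, ZMod.lift_coe]
  show (1 : ℤ) • ((n / 2 : ℕ) : ZMod n) = _
  rw [one_zsmul]

/-- `2c = 0` for every involution-candidate `c = (ε, (n/2)·δ)`… concretely: `(ε, n/2) + (ε, n/2) = 0` for even `n`. [folklore] -/
instance fact_eps_half (n : ℕ) [NeZero n] [Fact (2 ∣ n)] (ε : ZMod 2) :
    Fact ((((ε, ((n / 2 : ℕ) : ZMod n)) : ZMod 2 × ZMod n)) + (ε, ((n / 2 : ℕ) : ZMod n)) = 0) :=
  ⟨Prod.ext (by change ε + ε = 0; fin_cases ε <;> decide)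
    (by
      change ((n / 2 : ℕ) : ZMod n) + ((n / 2 : ℕ) : ZMod n) = 0
      rw [← Nat.cast_add, ← two_mul, Nat.mul_div_cancel' (Fact.out : 2 ∣ n), ZMod.natCast_self])⟩

/-- **The shear** `(a, b) ↦ (a, b + (n/2)·a)` of `ℤ₂ × ℤ_n` (`n` even), an additive automorphism (it is its own
inverse) with `(1, 0) ↦ (1, n/2)`. [folklore] -/
def shearEquiv (n : ℕ) [NeZero n] (hn : 2 ∣ n) : (ZMod 2 × ZMod n) ≃+ (ZMod 2 × ZMod n) where
  toFun p := (p.1, p.2 + halfHom n hn p.1)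
  invFun p := (p.1, p.2 - halfHom n hn p.1)
  left_inv p := by simp
  right_inv p := by simp
  map_add' p q := by
    refine Prod.ext rfl ?_
    show p.2 + q.2 + halfHom n hn (p.1 + q.1) = p.2 + halfHom n hn p.1 + (q.2 + halfHom n hn q.1)
    rw [map_add]; abel

/-- The shear sends `(1,0)` to `(1, n/2)`. [folklore] -/
theorem shearEquiv_one_zero (hn : 2 ∣ n) :
    shearEquiv n hn ((1 : ZMod 2), (0 : ZMod n)) = (1, ((n / 2 : ℕ) : ZMod n)) := by
  refine Prod.ext rfl ?_
  show (0 : ZMod n) + halfHom n hn 1 = ((n / 2 : ℕ) : ZMod n)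
  rw [zero_add, halfHom_one]

/-- **`G(ℤ₂ × ℤ_n, (1, n/2))` attains the mod-one law** for even `n ≡ 2 (mod 3)`, `n ≥ 3` (transport of
`z2zn_mod_one_law_attained` along the shear). [folklore] -/
theorem z2zn_mod_one_law_attained_one_half [Fact (2 ∣ n)] (hn : 3 ≤ n) (hmod : n % 3 = 2) :
    ∃ S T U : Finset (DihedralLikeGroup (ZMod 2 × ZMod n) ((1 : ZMod 2), ((n / 2 : ℕ) : ZMod n))),
      TripleProductProperty S T U ∧ 3 * (S.card * T.card * U.card) + 8 = 8 * Fintype.card (ZMod 2 × ZMod n) := by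
  have h2 : 2 ∣ n := Fact.out
  obtain ⟨S, T, U, h, hV⟩ := z2zn_mod_one_law_attained (n := n) (ε := 1) hn hmod
  let e := DihedralLikeGroup.congr (c₀ := ((1 : ZMod 2), (0 : ZMod n)))
    (c₀' := ((1 : ZMod 2), ((n / 2 : ℕ) : ZMod n))) (shearEquiv n h2) (shearEquiv_one_zero h2)
  obtain ⟨S', T', U', h', hV'⟩ := exists_tpp_volume_of_mulEquiv e ⟨S, T, U, h, rfl⟩
  exact ⟨S', T', U', h', by rw [hV']; exact hV⟩

/-- The endomorphism `(a, b) ↦ (b mod 2, a·(n/2) + b)` of `ℤ₂ × ℤ_n` (`n` even). [folklore] -/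
def swapHom (n : ℕ) [NeZero n] (hn : 2 ∣ n) : (ZMod 2 × ZMod n) →+ (ZMod 2 × ZMod n) :=
  AddMonoidHom.prod ((ZMod.castHom hn (ZMod 2)).toAddMonoidHom.comp (AddMonoidHom.snd (ZMod 2) (ZMod n)))
    ((halfHom n hn).comp (AddMonoidHom.fst (ZMod 2) (ZMod n)) + AddMonoidHom.snd (ZMod 2) (ZMod n))

/-- Pointwise formula for `swapHom`. [folklore] -/
theorem swapHom_apply (hn : 2 ∣ n) (p : ZMod 2 × ZMod n) :
    swapHom n hn p = (ZMod.castHom hn (ZMod 2) p.2, halfHom n hn p.1 + p.2) := rfl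

/-- For `n ≡ 2 (mod 4)` (`n/2` odd) the endomorphism `swapHom` is injective, hence an automorphism. [folklore] -/
theorem swapHom_injective (hn : 2 ∣ n) (hn4 : n % 4 = 2) : Function.Injective (swapHom n hn) := by
  rw [injective_iff_map_eq_zero]
  rintro ⟨a, b⟩ h
  rw [swapHom_apply, Prod.mk_eq_zero] at h
  obtain ⟨h1, h2⟩ := h
  have hodd : Odd (n / 2) := by
    rw [Nat.odd_iff]; omega
  by_cases ha : a = 0
  · subst ha
    rw [map_zero, zero_add] at h2
    subst h2; rfl
  · exfalso
    have ha1 : a = 1 := by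
      have key : ∀ x : ZMod 2, x ≠ 0 → x = 1 := by decide
      exact key a ha
    subst ha1
    have hb : b = -((n / 2 : ℕ) : ZMod n) := by rw [← halfHom_one hn]; exact eq_neg_of_add_eq_zero_right h2
    have h1' : (ZMod.castHom hn (ZMod 2)) b = 0 := h1
    rw [hb, map_neg, map_natCast, (ZMod.natCast_eq_one_iff_odd).2 hodd] at h1'
    exact absurd h1' (by decide)

/-- **The automorphism `(a,b) ↦ (b mod 2, a·(n/2) + b)` of `ℤ₂ × ℤ_n`, `n ≡ 2 (mod 4)`**, with `(1,0) ↦ (0, n/2)`. [folklore] -/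
noncomputable def swapEquiv (n : ℕ) [NeZero n] (hn : 2 ∣ n) (hn4 : n % 4 = 2) :
    (ZMod 2 × ZMod n) ≃+ (ZMod 2 × ZMod n) :=
  AddEquiv.ofBijective (swapHom n hn) (Finite.injective_iff_bijective.mp (swapHom_injective hn hn4))

/-- `swapEquiv (1,0) = (0, n/2)`. [folklore] -/
theorem swapEquiv_one_zero (hn : 2 ∣ n) (hn4 : n % 4 = 2) :
    swapEquiv n hn hn4 ((1 : ZMod 2), (0 : ZMod n)) = (0, ((n / 2 : ℕ) : ZMod n)) := by
  show swapHom n hn (1, 0) = _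
  rw [swapHom_apply]
  exact Prod.ext (by simp) (by show halfHom n hn 1 + 0 = _; rw [add_zero, halfHom_one])

/-- **`G(ℤ₂ × ℤ_n, (0, n/2))` attains the mod-one law when `n ≡ 2 (mod 4)`**, `n ≡ 2 (mod 3)` (so `n ≡ 2 (mod 12)`,
`|A| = 2n = 28, 52, 76, …`; these groups are `C₂ × Q_{2n}` with `n/2` odd) — transport of `z2zn_mod_one_law_attained`
along `swapEquiv`.  Contrast: for `4 ∣ n` the same presentation attains NO law triple (`no_mod_one_law_Z2_Zn_half`).
[folklore] -/
theorem z2zn_mod_one_law_attained_zero_half [Fact (2 ∣ n)] (hn4 : n % 4 = 2) (hn : 3 ≤ n) (hmod : n % 3 = 2) :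
    ∃ S T U : Finset (DihedralLikeGroup (ZMod 2 × ZMod n) ((0 : ZMod 2), ((n / 2 : ℕ) : ZMod n))),
      TripleProductProperty S T U ∧ 3 * (S.card * T.card * U.card) + 8 = 8 * Fintype.card (ZMod 2 × ZMod n) := by
  have h2 : 2 ∣ n := Fact.out
  obtain ⟨S, T, U, h, hV⟩ := z2zn_mod_one_law_attained (n := n) (ε := 1) hn hmod
  let e := DihedralLikeGroup.congr (c₀ := ((1 : ZMod 2), (0 : ZMod n)))
    (c₀' := ((0 : ZMod 2), ((n / 2 : ℕ) : ZMod n))) (swapEquiv n h2 hn4) (swapEquiv_one_zero h2 hn4)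
  obtain ⟨S', T', U', h', hV'⟩ := exists_tpp_volume_of_mulEquiv e ⟨S, T, U, h, rfl⟩
  exact ⟨S', T', U', h', by rw [hV']; exact hV⟩

end Z2Zn

end Summit.MatrixMultiplication.OmegaCensus
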